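import Literature.Computability.AlgebraicComplexity.BLMW11HomogenizedDetRepresentations
import Literature.Computability.AlgebraicComplexity.SkewCircuitAffineSubstitution
import Literature.Computability.AlgebraicComplexity.GCTProofs
import Literature.Computability.AlgebraicComplexity.ValiantCompleteness
import Literature.Computability.AlgebraicComplexity.BLMW11WeaklySkewToSkewProofs
import HarnessLib

/-!
# BLMW 2011, Prop. 9.3.2: the Mulmuley–Sohoni conjecture is equivalent to
`(per_m) ∉ \overline{VP_ws}` and to `VNP ⊄ \overline{VP_ws}` — discharge modulo §9.4 (iii)

Bürgisser–Landsberg–Manivel–Weyman, SIAM J. Comput. 40 (2011), Prop. 9.3.2 (arXiv:0907.2850,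
Prop. 9.2, p. 21): "Conjecture 1.1 [MS1] is equivalent to `(per_m) ∉ \overline{VP_ws}` and
equivalent to `VNP ⊄ \overline{VP_ws}`. … *Proof.* The second equivalence is a consequence of the
VNP completeness of `(per_m)`. To show the first equivalence suppose first that Conjecture 1.1 is
false. … There is a weakly-skew arithmetic circuit for `det_{m^c}` of size polynomial in `m`.
Composing this circuit with … the linear transformation `σ_k` yields a weakly-skew arithmetic
circuit for `f_k` of size at most `m^{c'}` … substituting `ℓ` by `1` … `\underline{L_ws}(per_m) ≤
m^{c'}` … To show the other direction … the universality of the determinant implies that `f_k` is a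
projection of `det_n` … we homogenize … Conjecture 1.1 would be false."

This file assembles the tree's rendering `BLMW2011_prop_9_3_2` (`BLMW11KroneckerApproximation.lean`)
from the three preceding proof files of cell `val-lit`, seat t14:

* first direction (unconditional): `approxWsComplexity_paddedPerPoly_le_of_hasBorderDetRepr`
  (every `B · det_M` has a small weakly-skew circuit, `wsComplexity_linSubst_detPoly_le` of
  `SkewCircuitAffineSubstitution.lean`, so `Δ[det_M] ⊆ closure{L_ws ≤ R(M)}`),
  `isProjection_perPoly_paddedPerPoly` ("substituting `ℓ` by `1`": `per_m` is a projection of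
  `ℓ^{M-m} per_m`), `approxWsComplexity_perPoly_le_of_hasBorderDetRepr`,
  **`isVPwsBarFamily_perPoly_of_not_borderDcPerSuperpolynomial`**;
* second direction (modulo (iii)): `not_isVPwsBarFamily_perPoly_of_skew_le_ws`
  (`BLMW11HomogenizedDetRepresentations.lean`);
* second equivalence: Valiant's completeness of the permanent, PROVED in the tree
  (`isVNPComplete_perPoly_holds ℂ`, `isVNPFamily_perPoly_holds ℂ`), with `\overline{VP_ws}` closed
  under p-projections and renaming (`BLMW11ApproximationProjections.lean`);
* **`BLMW2011_prop_9_3_2_of_skew_le_ws`**, **`BLMW2011_prop_9_3_2_of_sec9_detVPws`** — the fact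
  `BLMW2011_prop_9_3_2` follows from conjunct (iii) of `BLMW2011_sec9_detVPws` ("weakly skew ⇒
  skew with a linear size factor", [koka:08] = Kaltofen–Koiran 2008 / Malod–Portier), whose only
  use is the universality step `L_ws(f_k) < n ⇒ f_k = det(M_k)` of the printed proof; since that
  conjunct is a theorem of the tree (`BLMW2011_sec9_detVPws_holds`, seat t15), the fact is
  DISCHARGED: **`BLMW2011_prop_9_3_2_holds`**, with the two equivalences also exported separately
  (`borderDcPerSuperpolynomial_iff_not_isVPwsBarFamily_perPoly`,
  `borderDcPerSuperpolynomial_iff_not_vnp_subset_vpwsBar`) and the unconditional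
  `isVPwsBarFamily_perPoly_iff_vnp_subset_vpwsBar`. Nothing here asserts either side of the
  equivalences (`BorderDcPerSuperpolynomial` is an open conjecture; `VP ≠ VNP` is not proved).

Theorems only; no definitions, no named facts.

## References
* [BLMW 2011] SIAM J. Comput. 40 (2011), Prop. 9.3.2 (arXiv Prop. 9.2, p. 21). Bib key
  `BurgisserEtAl2011`.
-/

open MvPolynomial

namespace Literature.Computability.AlgebraicComplexity

/-! ### First direction: `\underline{dc}(per_m) ≤ M ⇒ \underline{L_ws}(per_m) ≤ poly(M)` -/

section FirstDirection

/-- **BLMW 2011, proof of Prop. 9.3.2 (first direction), closure step**: if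
`ℓ^{M-m} per_m ∈ \overline{GL_{M²}·det_M}` then `\underline{L_ws}(ℓ^{M-m} per_m) ≤ R(M)` with
`R(M) = ((M+2)(4M³+7)² + M²)(2M² + 3)`: every `σ · det_M` has a weakly-skew circuit of that size
(`wsComplexity_linSubst_detPoly_le`), so the orbit, hence its closure, lies in the (closure of
the) set `{g | L_ws(g) ≤ R(M)}`. [cite: BurgisserEtAl2011, Prop. 9.3.2 (proof, first direction)] -/
theorem approxWsComplexity_paddedPerPoly_le_of_hasBorderDetRepr {m M : ℕ} [NeZero M]
    (h : HasBorderDetRepr ℂ m M) :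
    approxWsComplexity (paddedPerPoly ℂ m M) ≤
      ((M + 2) * (4 * M ^ 3 + 7) ^ 2 + M * M) * (2 * (M * M) + 3) := by
  refine approxWsComplexity_le_of_mem (zariskiClosure_mono ?_ h)
  rintro _ ⟨_, ⟨g, rfl⟩, rfl⟩
  refine ⟨linSubstRep _ ℂ g (detPoly (Fin M) ℂ), ?_, rfl⟩
  show wsComplexity (linSubstRep _ ℂ g (detPoly (Fin M) ℂ)) ≤ _
  rw [linSubstRep_apply]
  exact wsComplexity_linSubst_detPoly_le ℂ M _

/-- **"Substituting `ℓ` by `1` and leaving the variables of `per_m` unchanged"** (BLMW 2011, proof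
of Prop. 9.3.2): `per_m` is a Valiant projection of the padded permanent `ℓ^{M-m} per_m`
(`m ≤ M`; the other matrix variables go to `1` as well). [cite: BurgisserEtAl2011, Prop. 9.3.2 (proof, first direction)] -/
theorem isProjection_perPoly_paddedPerPoly {m M : ℕ} [NeZero M] (hmM : m ≤ M) :
    IsProjection (perPoly (Fin m) ℂ) (paddedPerPoly ℂ m M) := by
  classical
  set e : Fin m ≃ BlockIdx m M := (Fintype.equivFinOfCardEq (card_blockIdx hmM)).symm with he
  -- the substitution: block variables ↦ the variables of `per_m`, everything else ↦ 1
  set a : Fin M × Fin M → MvPolynomial (Fin m × Fin m) ℂ := fun ij =>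
    if h : M - m ≤ (ij.1 : ℕ) ∧ M - m ≤ (ij.2 : ℕ) then
      X (e.symm ⟨ij.1, h.1⟩, e.symm ⟨ij.2, h.2⟩) else C 1 with ha
  refine ⟨a, fun ij => ?_, ?_⟩
  · by_cases h : M - m ≤ (ij.1 : ℕ) ∧ M - m ≤ (ij.2 : ℕ)
    · exact Or.inl ⟨_, by rw [ha]; exact dif_pos h⟩
    · exact Or.inr ⟨1, by rw [ha]; exact dif_neg h⟩
  · rw [paddedPerPoly, map_mul, map_pow, aeval_rename]
    -- the padding factor goes to `1`
    have hpad : (aeval a (X ((0 : Fin M), (0 : Fin M)) : MvPolynomial (Fin M × Fin M) ℂ)) ^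
        (M - m) = 1 := by
      rcases Nat.eq_zero_or_pos (M - m) with h0 | hpos
      · rw [h0, pow_zero]
      · rw [aeval_X, ha]
        simp only
        rw [dif_neg, map_one, one_pow]
        rintro ⟨h1, _⟩
        simp at h1
        omega
    rw [hpad, one_mul]
    -- the block goes to `per_m`
    have hcomp : (a ∘ fun ij : BlockIdx m M × BlockIdx m M => ((ij.1 : Fin M), (ij.2 : Fin M))) =
        fun ij => X (Prod.map e.symm e.symm ij) := by
      funext ij
      simp only [Function.comp_apply]
      rw [ha]
      simp only
      rw [dif_pos ⟨ij.1.2, ij.2.2⟩]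
      rfl
    have hr : (aeval fun ij : BlockIdx m M × BlockIdx m M =>
        (X (Prod.map e.symm e.symm ij) : MvPolynomial (Fin m × Fin m) ℂ)) =
        rename (Prod.map e.symm e.symm) := by
      ext ij
      simp
    rw [hcomp, hr, rename_perPoly_equiv]

/-- **BLMW 2011, proof of Prop. 9.3.2, first direction (pointwise)**:
`ℓ^{M-m} per_m ∈ Δ[det_M]`, `m ≤ M` ⇒ `\underline{L_ws}(per_m) ≤ ((M+2)(4M³+7)² + M²)(2M²+3)`
("Then `L_ws(f'_k) ≤ L_ws(f_k) ≤ m^{c'}` and `lim f'_k = per_m`. Hence, by definition,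
`\underline{L_ws}(per_m) ≤ m^{c'}`"; here via `IsProjection.approxWsComplexity_le`).
[cite: BurgisserEtAl2011, Prop. 9.3.2 (proof, first direction)] -/
theorem approxWsComplexity_perPoly_le_of_hasBorderDetRepr {m M : ℕ} [NeZero M] (hmM : m ≤ M)
    (h : HasBorderDetRepr ℂ m M) :
    approxWsComplexity (perPoly (Fin m) ℂ) ≤
      ((M + 2) * (4 * M ^ 3 + 7) ^ 2 + M * M) * (2 * (M * M) + 3) :=
  ((isProjection_perPoly_paddedPerPoly hmM).approxWsComplexity_le).trans
    (approxWsComplexity_paddedPerPoly_le_of_hasBorderDetRepr h)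

/-- **BLMW 2011, Prop. 9.3.2, first direction: if the Mulmuley–Sohoni "no constant `c`"
conjecture fails then `(per_m) ∈ \overline{VP_ws}`** — unconditional. A p-bounded border
determinantal complexity `m ↦ M(m) ≤ m^c + c` gives the p-bounded
`\underline{L_ws}(per_m) ≤ R(M(m))`. [cite: BurgisserEtAl2011, Prop. 9.3.2] -/
theorem isVPwsBarFamily_perPoly_of_not_borderDcPerSuperpolynomial
    (h : ¬ BorderDcPerSuperpolynomial) : IsVPwsBarFamily (fun m => perPoly (Fin m) ℂ) := by
  classical
  unfold BorderDcPerSuperpolynomial at h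
  rw [not_not] at h
  obtain ⟨c, hc⟩ := h
  choose M hM hle hbound hrepr using hc
  have hMp : IsPBounded M := ⟨c, hbound⟩
  have hR : IsPBounded fun M : ℕ => ((M + 2) * (4 * M ^ 3 + 7) ^ 2 + M * M) * (2 * (M * M) + 3) :=
    IsPBounded.mul_holds
      (IsPBounded.add_holds
        (IsPBounded.mul_holds (IsPBounded.add_holds IsPBounded.id (IsPBounded.const 2))
          (IsPBounded.pow_holds (IsPBounded.add_holds (IsPBounded.mul_holds (IsPBounded.const 4)
            (IsPBounded.pow_holds IsPBounded.id 3)) (IsPBounded.const 7)) 2))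
        (IsPBounded.mul_holds IsPBounded.id IsPBounded.id))
      (IsPBounded.add_holds (IsPBounded.mul_holds (IsPBounded.const 2)
        (IsPBounded.mul_holds IsPBounded.id IsPBounded.id)) (IsPBounded.const 3))
  refine (IsPBounded.comp_holds hR hMp).mono fun n => ?_
  haveI := hM n
  exact approxWsComplexity_perPoly_le_of_hasBorderDetRepr (hle n) (hrepr n)

/-- Contrapositive: **`(per_m) ∉ \overline{VP_ws}` implies the Mulmuley–Sohoni "no constant `c`"
conjecture** (BLMW 2011, Prop. 9.3.2, first equivalence, direction ⇐; unconditional).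
[cite: BurgisserEtAl2011, Prop. 9.3.2] -/
theorem borderDcPerSuperpolynomial_of_not_isVPwsBarFamily_perPoly
    (h : ¬ IsVPwsBarFamily (fun m => perPoly (Fin m) ℂ)) : BorderDcPerSuperpolynomial := by
  by_contra hMS
  exact h (isVPwsBarFamily_perPoly_of_not_borderDcPerSuperpolynomial hMS)

end FirstDirection

/-! ### The second equivalence: VNP-completeness of the permanent -/

section SecondEquivalence

/-- **`(per_m) ∈ \overline{VP_ws}` ⇒ `VNP ⊆ \overline{VP_ws}`** (BLMW 2011, proof of Prop. 9.3.2: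
"The second equivalence is a consequence of the VNP completeness of `(per_m)`"): every `VNP`
family is a p-projection of the permanent (`isVNPComplete_perPoly_holds ℂ`, Valiant 1979, PROVED
in the tree) and `\overline{VP_ws}` is closed under p-projections
(`IsVPwsBarFamily.of_isPProjection`). [cite: BurgisserEtAl2011, Prop. 9.3.2 (second equivalence)] -/
theorem vnp_subset_vpwsBar_of_isVPwsBarFamily_perPoly
    (hper : IsVPwsBarFamily (fun m => perPoly (Fin m) ℂ))
    (v : ℕ → ℕ) (f : ∀ n, MvPolynomial (Fin (v n)) ℂ) (hf : IsVNPFamily f) :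
    IsVPwsBarFamily f := by
  have hchar : ringChar ℂ ≠ 2 := by rw [ringChar.eq_zero]; norm_num
  exact hper.of_isPProjection (((isVNPComplete_perPoly_holds ℂ) hchar).2 v f hf)

/-- **`VNP ⊆ \overline{VP_ws}` ⇒ `(per_m) ∈ \overline{VP_ws}`** (BLMW 2011, proof of Prop. 9.3.2):
the permanent family, renamed to the variables `Fin (m·m)`, is in `VNP`
(`isVNPFamily_perPoly_holds ℂ`, `isVNPFamily_renameEquiv_iff`), and `\overline{VP_ws}` membership
is invariant under that renaming (`isVPwsBarFamily_rename_equiv_iff`).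
[cite: BurgisserEtAl2011, Prop. 9.3.2 (second equivalence)] -/
theorem isVPwsBarFamily_perPoly_of_vnp_subset_vpwsBar
    (H : ∀ (v : ℕ → ℕ) (f : ∀ n, MvPolynomial (Fin (v n)) ℂ), IsVNPFamily f → IsVPwsBarFamily f) :
    IsVPwsBarFamily (fun m => perPoly (Fin m) ℂ) := by
  have hvnp : IsVNPFamily (fun n => rename (finProdFinEquiv (m := n) (n := n))
      (perPoly (Fin n) ℂ)) := by
    have h := (isVNPFamily_renameEquiv_iff (σ := fun n => Fin n × Fin n)
      (fun n => finProdFinEquiv (m := n) (n := n)) (fun n => perPoly (Fin n) ℂ)).2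
      (isVNPFamily_perPoly_holds ℂ)
    simpa only [renameEquiv_apply] using h
  have hbar := H (fun n => n * n) _ hvnp
  exact (isVPwsBarFamily_rename_equiv_iff (fun n => finProdFinEquiv (m := n) (n := n))
    (fun n => perPoly (Fin n) ℂ)).1 hbar

end SecondEquivalence

/-! ### Assembly -/

section Assembly

/-- **BLMW 2011, Prop. 9.3.2, from §9.4 (iii).** If skew circuits simulate weakly-skew ones with
a linear size factor (conjunct (iii) of `BLMW2011_sec9_detVPws`, [koka:08]), then the tree's
`BLMW2011_prop_9_3_2` holds: the Mulmuley–Sohoni "no constant `c`" conjecture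
(`BorderDcPerSuperpolynomial`) is equivalent to `(per_m) ∉ \overline{VP_ws}` and to
`VNP ⊄ \overline{VP_ws}`. The hypothesis is used only for the universality step of the second
direction (`not_isVPwsBarFamily_perPoly_of_skew_le_ws`); the first direction and the second
equivalence are unconditional. [cite: BurgisserEtAl2011, Prop. 9.3.2] -/
theorem BLMW2011_prop_9_3_2_of_skew_le_ws
    (h3 : ∃ c : ℕ, ∀ {σ : Type} [Fintype σ] (f : MvPolynomial σ ℂ),
      skewComplexity f ≤ c * wsComplexity f) :
    BLMW2011_prop_9_3_2 := by
  have h1 : BorderDcPerSuperpolynomial ↔ ¬ IsVPwsBarFamily fun m => perPoly (Fin m) ℂ :=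
    ⟨not_isVPwsBarFamily_perPoly_of_skew_le_ws h3,
      borderDcPerSuperpolynomial_of_not_isVPwsBarFamily_perPoly⟩
  refine ⟨h1, ?_⟩
  rw [h1]
  constructor
  · intro hper H
    exact hper (isVPwsBarFamily_perPoly_of_vnp_subset_vpwsBar H)
  · intro hH hper
    exact hH (vnp_subset_vpwsBar_of_isVPwsBarFamily_perPoly hper)

/-- **BLMW 2011, Prop. 9.3.2 from `BLMW2011_sec9_detVPws`** (of which only conjunct (iii) is used;
that fact is a theorem of the tree, `BLMW2011_sec9_detVPws_holds`, `BLMW11WeaklySkewToSkewProofs.lean`,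
whence `BLMW2011_prop_9_3_2_holds` below). [cite: BurgisserEtAl2011, Prop. 9.3.2] -/
theorem BLMW2011_prop_9_3_2_of_sec9_detVPws (h : BLMW2011_sec9_detVPws) : BLMW2011_prop_9_3_2 :=
  BLMW2011_prop_9_3_2_of_skew_le_ws h.2.2

/-- The two unconditional thirds of Prop. 9.3.2 packaged: (a) `(per_m) ∉ \overline{VP_ws} ⇒ MS`
and (b) `(per_m) ∉ \overline{VP_ws} ⇔ VNP ⊄ \overline{VP_ws}`.
[cite: BurgisserEtAl2011, Prop. 9.3.2] -/
theorem BLMW2011_prop_9_3_2_unconditional_part :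
    (¬ IsVPwsBarFamily (fun m => perPoly (Fin m) ℂ) → BorderDcPerSuperpolynomial) ∧
    (¬ IsVPwsBarFamily (fun m => perPoly (Fin m) ℂ) ↔
      ¬ ∀ (v : ℕ → ℕ) (f : ∀ n, MvPolynomial (Fin (v n)) ℂ), IsVNPFamily f → IsVPwsBarFamily f) := by
  refine ⟨borderDcPerSuperpolynomial_of_not_isVPwsBarFamily_perPoly, ?_, ?_⟩
  · intro hper H
    exact hper (isVPwsBarFamily_perPoly_of_vnp_subset_vpwsBar H)
  · intro hH hper
    exact hH (vnp_subset_vpwsBar_of_isVPwsBarFamily_perPoly hper)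

/-- **Discharge of `BLMW2011_prop_9_3_2` (BLMW 2011, Prop. 9.3.2).** The Mulmuley–Sohoni
"no constant `c`" conjecture (`BorderDcPerSuperpolynomial`, BLMW Conj. 1.1) is equivalent to
`(per_m) ∉ \overline{VP_ws}` and to `VNP ⊄ \overline{VP_ws}` — unconditionally, conjunct (iii) of
`BLMW2011_sec9_detVPws` ("weakly skew ⇒ skew with a linear size factor") being a theorem of the
tree (`BLMW2011_sec9_detVPws_holds`, `BLMW11WeaklySkewToSkewProofs.lean`, cell `val-lit` seat t15).
An equivalence of two open statements; neither side is asserted. [cite: BurgisserEtAl2011, Prop. 9.3.2] -/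
theorem BLMW2011_prop_9_3_2_holds : BLMW2011_prop_9_3_2 :=
  BLMW2011_prop_9_3_2_of_sec9_detVPws BLMW2011_sec9_detVPws_holds

/-- **BLMW 2011, Prop. 9.3.2, first equivalence**: the Mulmuley–Sohoni "no constant `c`" conjecture
holds iff `(per_m) ∉ \overline{VP_ws}`. [cite: BurgisserEtAl2011, Prop. 9.3.2] -/
theorem borderDcPerSuperpolynomial_iff_not_isVPwsBarFamily_perPoly :
    BorderDcPerSuperpolynomial ↔ ¬ IsVPwsBarFamily (fun m => perPoly (Fin m) ℂ) :=
  BLMW2011_prop_9_3_2_holds.1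

/-- **BLMW 2011, Prop. 9.3.2, second equivalence**: the Mulmuley–Sohoni "no constant `c`"
conjecture holds iff `VNP ⊄ \overline{VP_ws}` (families in variables `Fin (v n)`).
[cite: BurgisserEtAl2011, Prop. 9.3.2] -/
theorem borderDcPerSuperpolynomial_iff_not_vnp_subset_vpwsBar :
    BorderDcPerSuperpolynomial ↔
      ¬ ∀ (v : ℕ → ℕ) (f : ∀ n, MvPolynomial (Fin (v n)) ℂ), IsVNPFamily f → IsVPwsBarFamily f :=
  BLMW2011_prop_9_3_2_holds.2

/-- **`(per_m) ∈ \overline{VP_ws} ↔ VNP ⊆ \overline{VP_ws}`** (the VNP-completeness step of BLMW 2011,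
Prop. 9.3.2, stated positively; unconditional). [cite: BurgisserEtAl2011, Prop. 9.3.2 (second equivalence)] -/
theorem isVPwsBarFamily_perPoly_iff_vnp_subset_vpwsBar :
    IsVPwsBarFamily (fun m => perPoly (Fin m) ℂ) ↔
      ∀ (v : ℕ → ℕ) (f : ∀ n, MvPolynomial (Fin (v n)) ℂ), IsVNPFamily f → IsVPwsBarFamily f :=
  ⟨vnp_subset_vpwsBar_of_isVPwsBarFamily_perPoly, isVPwsBarFamily_perPoly_of_vnp_subset_vpwsBar⟩

end Assembly

end Literature.Computability.AlgebraicComplexity
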